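import Mathlib
import HarnessLib
import Summits.RiemannHypothesis.RiemannHypothesis.Theorems.EarlyAppointmentsRemainder0XiFarFieldReindex

/-!
# ⟨24730⟩ ρ2 v4 — LEAF 1 (`KernelShiftLeaf`), the POINTWISE kernel-shift inequality, PROVED

C4 «kernel desk» rh-idea-6 g30, director (CA406)(d).  SUPPORT module for crux r3 `Remainder0Xi` (line rho2_v4), fully proved,
Mathlib only, standard axioms.

LEAF 1 compares the far Hadamard PAIR sum `Σ_far ord·2w/(w² − u²)` with the real height sum `Σ_far ord·2x/(x² − (Re u)²)`,
`x = Re w`.  The pointwise input is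
★ `kernel_shift_pointwise`: for `|Im w| ≤ ½`, `|Im u| ≤ ½`, `Re w > 0`, `Re u > 0`, `Re u ≠ Re w`,
  `‖2w/(w² − u²) − 2x/(x² − γ²)‖ ≤ 2/(x − γ)²`   (`x = Re w`, `γ = Re u`),
from the partial fractions `2w/(w²−u²) = (w−u)⁻¹ + (w+u)⁻¹`, `2x/(x²−γ²) = (x−γ)⁻¹ + (x+γ)⁻¹` and the two shifts
`‖(w∓u)⁻¹ − (x∓γ)⁻¹‖ = |Im w ∓ Im u|/(‖w∓u‖·|x∓γ|) ≤ 1/(x∓γ)²` (`inv_sub_shift_le`, `inv_add_shift_le`).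
Summing `2·ord/(x − γ)²` over the far zeros by the Abel engine (…HeightSumAbelBound / …AbelHighSide with `φ = 2/(t − x)²`) gives
`cS·log(γ₀/2π)` with `cS = 1/(67.5π) + 4κ/67.5² ≈ 0.00518` (C3 g41) — that summation is the remaining step of LEAF 1.
Nothing here bears on the truth of RH; RH is not proved; 24730 OPEN.
-/

set_option linter.dupNamespace false
namespace Summit.RiemannHypothesis.RiemannHypothesis.Theorems.EarlyAppointmentsRemainder0Xi.KernelShiftPointwise

open Summit.RiemannHypothesis.RiemannHypothesis.Theorems.EarlyAppointmentsRemainder0Xi.FarFieldReindex (pair_split)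

/-- (K) alias for `pair_split` (partial fractions in `ℂ`). -/
private abbrev pair_kernel_eq := @pair_split

/-- partial fractions in `ℝ`: `2x/(x² − γ²) = (x − γ)⁻¹ + (x + γ)⁻¹` for `x ≠ ±γ`. -/
theorem real_kernel_eq {x γ : ℝ} (h1 : x - γ ≠ 0) (h2 : x + γ ≠ 0) :
    2 * x / (x ^ 2 - γ ^ 2) = (x - γ)⁻¹ + (x + γ)⁻¹ := by
  have h3 : x ^ 2 - γ ^ 2 = (x - γ) * (x + γ) := by ring
  rw [h3]
  field_simp
  ring

/-- the generic shift estimate: `‖z⁻¹ − (Re z)⁻¹‖ ≤ |Im z|/(Re z)²` in the form `≤ M/(Re z)²` given `|Im z| ≤ M`, `Re z ≠ 0`. -/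
theorem norm_inv_sub_inv_re_le {z : ℂ} {M : ℝ} (hz : z.re ≠ 0) (hM : |z.im| ≤ M) :
    ‖z⁻¹ - ((z.re : ℝ) : ℂ)⁻¹‖ ≤ M / z.re ^ 2 := by
  have hM0 : 0 ≤ M := le_trans (abs_nonneg _) hM
  have hz0 : z ≠ 0 := fun h ↦ hz (by rw [h]; simp)
  have hzC : ((z.re : ℝ) : ℂ) ≠ 0 := by exact_mod_cast hz
  have e : z⁻¹ - ((z.re : ℝ) : ℂ)⁻¹ = (((z.re : ℝ) : ℂ) - z) / (z * ((z.re : ℝ) : ℂ)) := by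
    field_simp
  have hnum : ‖((z.re : ℝ) : ℂ) - z‖ = |z.im| := by
    have e2 : ((z.re : ℝ) : ℂ) - z = ((-z.im : ℝ) : ℂ) * Complex.I := by
      apply Complex.ext <;> simp
    rw [e2, norm_mul, Complex.norm_I, mul_one, Complex.norm_real, Real.norm_eq_abs, abs_neg]
  have hre : |z.re| ≤ ‖z‖ := Complex.abs_re_le_norm z
  have hzn : 0 < ‖z‖ := norm_pos_iff.2 hz0
  have hra : 0 < |z.re| := abs_pos.2 hz
  rw [e, norm_div, norm_mul, Complex.norm_real, Real.norm_eq_abs, hnum, div_le_div_iff₀ (by positivity) (by positivity)]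
  have h1 : |z.im| * z.re ^ 2 ≤ M * z.re ^ 2 := mul_le_mul_of_nonneg_right hM (sq_nonneg _)
  have h2 : M * z.re ^ 2 = M * (|z.re| * |z.re|) := by rw [← sq_abs, sq]
  have h3 : M * (|z.re| * |z.re|) ≤ M * (‖z‖ * |z.re|) :=
    mul_le_mul_of_nonneg_left (mul_le_mul_of_nonneg_right hre hra.le) hM0
  linarith

/-- `‖(w − u)⁻¹ − (Re w − Re u)⁻¹‖ ≤ 1/(Re w − Re u)²` when `|Im w|, |Im u| ≤ ½` and `Re w ≠ Re u`. -/
theorem inv_sub_shift_le {w u : ℂ} (hw : |w.im| ≤ 1 / 2) (hu : |u.im| ≤ 1 / 2) (hne : w.re ≠ u.re) :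
    ‖(w - u)⁻¹ - ((w.re - u.re : ℝ) : ℂ)⁻¹‖ ≤ 1 / (w.re - u.re) ^ 2 := by
  have hz : (w - u).re ≠ 0 := by rw [Complex.sub_re]; exact sub_ne_zero.2 hne
  have hM : |(w - u).im| ≤ 1 := by
    rw [Complex.sub_im]
    have := abs_sub (w.im) (u.im)
    linarith
  have h := norm_inv_sub_inv_re_le hz hM
  rw [Complex.sub_re] at h
  exact h

/-- `‖(w + u)⁻¹ − (Re w + Re u)⁻¹‖ ≤ 1/(Re w + Re u)²` when `|Im w|, |Im u| ≤ ½` and `Re w + Re u ≠ 0`. -/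
theorem inv_add_shift_le {w u : ℂ} (hw : |w.im| ≤ 1 / 2) (hu : |u.im| ≤ 1 / 2) (hne : w.re + u.re ≠ 0) :
    ‖(w + u)⁻¹ - ((w.re + u.re : ℝ) : ℂ)⁻¹‖ ≤ 1 / (w.re + u.re) ^ 2 := by
  have hz : (w + u).re ≠ 0 := by rw [Complex.add_re]; exact hne
  have hM : |(w + u).im| ≤ 1 := by
    rw [Complex.add_im]
    have := abs_add_le (w.im) (u.im)
    linarith
  have h := norm_inv_sub_inv_re_le hz hM
  rw [Complex.add_re] at h
  exact h

/-- ★ (K) **LEAF 1 pointwise**: `‖2w/(w² − u²) − 2x/(x² − γ²)‖ ≤ 2/(x − γ)²` (`x = Re w > 0`, `γ = Re u > 0`, `γ ≠ x`,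
`|Im w| ≤ ½`, `|Im u| ≤ ½`). -/
theorem kernel_shift_pointwise {w u : ℂ} (hw : |w.im| ≤ 1 / 2) (hu : |u.im| ≤ 1 / 2) (hx : 0 < w.re) (hγ : 0 < u.re)
    (hne : w.re ≠ u.re) :
    ‖2 * w / (w ^ 2 - u ^ 2) - ((2 * w.re / (w.re ^ 2 - u.re ^ 2) : ℝ) : ℂ)‖ ≤ 2 / (w.re - u.re) ^ 2 := by
  have hwu : w - u ≠ 0 := by
    intro h
    apply hne
    have := congrArg Complex.re h
    simpa [sub_eq_zero] using this
  have hsum : w.re + u.re ≠ 0 := by linarith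
  have hwu' : w + u ≠ 0 := by
    intro h
    apply hsum
    have := congrArg Complex.re h
    simpa using this
  have e4 : ((2 * w.re / (w.re ^ 2 - u.re ^ 2) : ℝ) : ℂ) = ((w.re - u.re : ℝ) : ℂ)⁻¹ + ((w.re + u.re : ℝ) : ℂ)⁻¹ := by
    rw [real_kernel_eq (sub_ne_zero.2 hne) hsum]
    push_cast
    ring
  rw [pair_kernel_eq hwu hwu', e4]
  have e3 : (w - u)⁻¹ + (w + u)⁻¹ - (((w.re - u.re : ℝ) : ℂ)⁻¹ + ((w.re + u.re : ℝ) : ℂ)⁻¹) =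
      ((w - u)⁻¹ - ((w.re - u.re : ℝ) : ℂ)⁻¹) + ((w + u)⁻¹ - ((w.re + u.re : ℝ) : ℂ)⁻¹) := by ring
  rw [e3]
  have hA := inv_sub_shift_le hw hu hne
  have hB := inv_add_shift_le hw hu hsum
  have hd2 : 0 < (w.re - u.re) ^ 2 := by
    have := sub_ne_zero.2 hne
    positivity
  have hmono : 1 / (w.re + u.re) ^ 2 ≤ 1 / (w.re - u.re) ^ 2 :=
    one_div_le_one_div_of_le hd2 (by nlinarith)
  have e5 : 2 / (w.re - u.re) ^ 2 = 1 / (w.re - u.re) ^ 2 + 1 / (w.re - u.re) ^ 2 := by ring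
  calc ‖((w - u)⁻¹ - ((w.re - u.re : ℝ) : ℂ)⁻¹) + ((w + u)⁻¹ - ((w.re + u.re : ℝ) : ℂ)⁻¹)‖
      ≤ ‖(w - u)⁻¹ - ((w.re - u.re : ℝ) : ℂ)⁻¹‖ + ‖(w + u)⁻¹ - ((w.re + u.re : ℝ) : ℂ)⁻¹‖ := norm_add_le _ _
    _ ≤ 1 / (w.re - u.re) ^ 2 + 1 / (w.re + u.re) ^ 2 := add_le_add hA hB
    _ ≤ 2 / (w.re - u.re) ^ 2 := by rw [e5]; linarith

/-- ★ (K) the SHARP two-term form: `‖2w/(w² − u²) − 2x/(x² − γ²)‖ ≤ 1/(x − γ)² + 1/(x + γ)²` (the `(x+γ)`-term sums to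
`O(log x / x)`; with it LEAF 1's coefficient is C3's `cS = 1/(67.5π) + 4κ/67.5² ≈ 0.00518`, with the crude `2/(x−γ)²` form it doubles). -/
theorem kernel_shift_pointwise_sharp {w u : ℂ} (hw : |w.im| ≤ 1 / 2) (hu : |u.im| ≤ 1 / 2) (hx : 0 < w.re) (hγ : 0 < u.re)
    (hne : w.re ≠ u.re) :
    ‖2 * w / (w ^ 2 - u ^ 2) - ((2 * w.re / (w.re ^ 2 - u.re ^ 2) : ℝ) : ℂ)‖ ≤
      1 / (w.re - u.re) ^ 2 + 1 / (w.re + u.re) ^ 2 := by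
  have hwu : w - u ≠ 0 := by
    intro h
    apply hne
    have := congrArg Complex.re h
    simpa [sub_eq_zero] using this
  have hsum : w.re + u.re ≠ 0 := by linarith
  have hwu' : w + u ≠ 0 := by
    intro h
    apply hsum
    have := congrArg Complex.re h
    simpa using this
  have e4 : ((2 * w.re / (w.re ^ 2 - u.re ^ 2) : ℝ) : ℂ) = ((w.re - u.re : ℝ) : ℂ)⁻¹ + ((w.re + u.re : ℝ) : ℂ)⁻¹ := by
    rw [real_kernel_eq (sub_ne_zero.2 hne) hsum]
    push_cast
    ring
  rw [pair_kernel_eq hwu hwu', e4]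
  have e3 : (w - u)⁻¹ + (w + u)⁻¹ - (((w.re - u.re : ℝ) : ℂ)⁻¹ + ((w.re + u.re : ℝ) : ℂ)⁻¹) =
      ((w - u)⁻¹ - ((w.re - u.re : ℝ) : ℂ)⁻¹) + ((w + u)⁻¹ - ((w.re + u.re : ℝ) : ℂ)⁻¹) := by ring
  rw [e3]
  exact (norm_add_le _ _).trans (add_le_add (inv_sub_shift_le hw hu hne) (inv_add_shift_le hw hu hsum))

/-- (K) sharp scalar form with multiplicity. -/
theorem kernel_shift_pointwise_sharp_mul {w u : ℂ} (hw : |w.im| ≤ 1 / 2) (hu : |u.im| ≤ 1 / 2) (hx : 0 < w.re)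
    (hγ : 0 < u.re) (hne : w.re ≠ u.re) (n : ℕ) :
    ‖(n : ℂ) * 2 * w / (w ^ 2 - u ^ 2) - (((n : ℝ) * (2 * w.re / (w.re ^ 2 - u.re ^ 2)) : ℝ) : ℂ)‖
      ≤ (n : ℝ) * (1 / (w.re - u.re) ^ 2 + 1 / (w.re + u.re) ^ 2) := by
  have h := kernel_shift_pointwise_sharp hw hu hx hγ hne
  have e : (n : ℂ) * 2 * w / (w ^ 2 - u ^ 2) - (((n : ℝ) * (2 * w.re / (w.re ^ 2 - u.re ^ 2)) : ℝ) : ℂ) =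
      (n : ℂ) * (2 * w / (w ^ 2 - u ^ 2) - ((2 * w.re / (w.re ^ 2 - u.re ^ 2) : ℝ) : ℂ)) := by
    push_cast
    ring
  rw [e, norm_mul, Complex.norm_natCast]
  exact mul_le_mul_of_nonneg_left h (Nat.cast_nonneg n)

/-- (K) the scalar form used with multiplicities: `‖(n:ℂ)·2w/(w²−u²) − ((n·2x/(x²−γ²) : ℝ) : ℂ)‖ ≤ n · 2/(x − γ)²`. -/
theorem kernel_shift_pointwise_mul {w u : ℂ} (hw : |w.im| ≤ 1 / 2) (hu : |u.im| ≤ 1 / 2) (hx : 0 < w.re) (hγ : 0 < u.re)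
    (hne : w.re ≠ u.re) (n : ℕ) :
    ‖(n : ℂ) * 2 * w / (w ^ 2 - u ^ 2) - (((n : ℝ) * (2 * w.re / (w.re ^ 2 - u.re ^ 2)) : ℝ) : ℂ)‖
      ≤ (n : ℝ) * (2 / (w.re - u.re) ^ 2) := by
  have h := kernel_shift_pointwise hw hu hx hγ hne
  have e : (n : ℂ) * 2 * w / (w ^ 2 - u ^ 2) - (((n : ℝ) * (2 * w.re / (w.re ^ 2 - u.re ^ 2)) : ℝ) : ℂ) =
      (n : ℂ) * (2 * w / (w ^ 2 - u ^ 2) - ((2 * w.re / (w.re ^ 2 - u.re ^ 2) : ℝ) : ℂ)) := by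
    push_cast
    ring
  rw [e, norm_mul, Complex.norm_natCast]
  exact mul_le_mul_of_nonneg_left h (Nat.cast_nonneg n)

end Summit.RiemannHypothesis.RiemannHypothesis.Theorems.EarlyAppointmentsRemainder0Xi.KernelShiftPointwise
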